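import Summits.CriticalPhenomena.Ising3DConformalLimit.Theorems.EnergyNotSigmaSquaredGapForcesFarMergingScreeningDefs
import Summits.CriticalPhenomena.Ising3DConformalLimit.Theorems.EnergyNotSigmaSquaredGapForcesFarMergingEnergyFactorisation
import Literature.Probability.LatticeModels.SourcedDoubleCurrentsSwitchingProofs

/-!
# One-pinch screening decay from the one-pinch gap
(line `screening-form-lemma-a1` of crux `GapForcesFarMerging`, item stmt-CriticalPhenomena-4468;
stub `stub_screeningDecay`)

Statement: `ScreeningIdentity → OnePinchGap → OnePinchScreeningDecay`. In words: if the one-pinch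
truncated correlation `⟨σ₀σ_{e₂} ; σ_{up m}σ_{dn m}⟩` is `≤ C(2m)^{-κ'}G(2me₁)²` (`OnePinchGap`), then
along infinitely many far scales `m`, eventually in the box size `n`, the full one-pinch mean
screening `pinchScreen n n m` (which the dictionary `ScreeningIdentity` identifies with the box
two-current avoidance probability `1 - P^{0 up, e₂ dn}_{Λ_n}[0 ↔ e₂]`) is `≤ C' m^{-κ'}`.

Proof route.
1. Infinite volume: Aizenman's factorisation of the truncated four-point function at `β_c`
   (`energyFactorisation_criticalCorr`, ADC21 (3.11) averaged over the two cross pairings) has two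
   nonnegative summands, so `OnePinchGap` bounds the first:
   `G(0,up m)G(e₂,dn m)(1 - P_∞[0 ↔ e₂]) ≤ C(2m)^{-κ'}G(2me₁)²`.
2. Messager–Miracle-Solé in the sup norm (ADC21 (5.3), `twoPointPlus_le_of_mul_supNorm_le`):
   `G(0,up m), G(e₂,dn m) ≥ G(8me₁)` since `3‖up m‖_∞ = 3‖dn m - e₂‖_∞ = 6m ≤ 8m`.
3. Doubling pigeonhole: `G(2me₁) ≤ 64·G(8me₁)` for an unbounded set of `m` — otherwise
   `G(2m₀4^k e₁) < 64^{-k}`, against the lower bound `G(x) ≥ c‖x‖⁻²` (`criticalTwoPoint_bounds`).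
   At such scales `1 - P_∞[0 ↔ e₂] ≤ 4096·max(C,0)·m^{-κ'}`.
4. Box passage: `P_{Λ_n}[0 ↔ e₂] → P_∞[0 ↔ e₂]` (`tendsto_sourcedDoubleCurrentLaw_real_openConn`), so
   eventually in `n` the box avoidance exceeds the limit by less than the slack `m^{-κ'}`, and
   `ScreeningIdentity` (all four points lie in `Λ_n` for large `n`) rewrites it as `pinchScreen n n m`.

References: M. Aizenman, H. Duminil-Copin, Ann. Math. 194 (2021), eqs. (3.11), (5.3), Lemma A.1
[AizenmanDuminilCopinAnnals2021]; A. Messager, S. Miracle-Solé, J. Stat. Phys. 17 (1977)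
[MessagerMiracleSoleJSP1977]; H. Duminil-Copin, Lectures on the Ising and Potts models (2019), Thm 4.8.
-/

noncomputable section

namespace Summit.CriticalPhenomena.Ising3DConformalLimit.EnergyNotSigmaSquaredGapForcesFarMerging

open scoped symmDiff ENNReal
open MeasureTheory Filter Finset
open Literature.Probability.LatticeModels Literature.Probability.Percolation
open Summit.CriticalPhenomena.Ising3DConformalLimit.Theorems.GapForcesFarMerging.Negative
  (e₁ e₂ cc2 xR up dn FarMergingShape SinglePinchLawShape softPackageNoBubble_criticalCorr)
open Summit.CriticalPhenomena.Ising3DConformalLimit.GapForcesFarMergingScreening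

/-! ### Geometry of the far targets `up m = (2m, m, 0)`, `dn m = (2m, -m, 0)`, `xR n = 2n e₁` -/

/-- `‖up m‖_∞ ≤ 2m`. [folklore] -/
theorem supNorm_up_le (m : ℕ) : Site.supNorm (up m) ≤ 2 * m := by
  rw [Site.supNorm_le_iff]
  intro i
  fin_cases i <;> simp [up, xR] <;> omega

/-- `‖dn m - e₂‖_∞ ≤ 2m` for `m ≥ 1`. [folklore] -/
theorem supNorm_dn_sub_e₂_le {m : ℕ} (hm : 1 ≤ m) : Site.supNorm (dn m - e₂) ≤ 2 * m := by
  rw [Site.supNorm_le_iff]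
  intro i
  fin_cases i <;> simp [dn, xR, e₂] <;> omega

/-- `8m ≤ ‖xR (4m)‖_∞`. [folklore] -/
theorem le_supNorm_xR_four_mul (m : ℕ) : 8 * m ≤ Site.supNorm (xR (4 * m)) := by
  have h := Site.natAbs_le_supNorm (xR (4 * m)) 0
  have h0 : (xR (4 * m)) 0 = 2 * ((4 * m : ℕ) : ℤ) := by simp [xR]
  rw [h0] at h
  omega

/-- `‖xR n‖ = 2n` (sup norm). [folklore] -/
theorem norm_xR (n : ℕ) : ‖xR n‖ = 2 * (n : ℝ) := by
  have h : Site.supNorm (xR n) = 2 * n := by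
    show Site.supNorm (Pi.single 0 (2 * (n : ℤ)) : Site 3) = 2 * n
    rw [Site.supNorm_single]
    omega
  rw [Site.norm_eq_supNorm, h]
  push_cast
  ring

/-! ### Messager–Miracle-Solé: the normalising pair correlators dominate `G(8me₁)` -/

/-- Sup-norm MMS comparison for the upper far target: `⟨σ₀σ_{8me₁}⟩ ≤ ⟨σ₀σ_{up m}⟩`, since
`3‖up m‖_∞ ≤ 8m = ‖8me₁‖_∞`. [cite: AizenmanDuminilCopinAnnals2021, §5.1 eq. (5.3)] -/
theorem cc2_xR_four_mul_le_cc2_up (m : ℕ) : cc2 0 (xR (4 * m)) ≤ cc2 0 (up m) := by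
  show criticalCorr 3 2 ![0, xR (4 * m)] ≤ criticalCorr 3 2 ![0, up m]
  rw [criticalCorr_two_pair, criticalCorr_two_pair, sub_zero, sub_zero]
  apply twoPointPlus_le_of_mul_supNorm_le (criticalBeta_nonneg 3)
  calc 3 * Site.supNorm (up m) ≤ 3 * (2 * m) := Nat.mul_le_mul_left _ (supNorm_up_le m)
    _ ≤ 8 * m := by omega
    _ ≤ Site.supNorm (xR (4 * m)) := le_supNorm_xR_four_mul m

/-- Sup-norm MMS comparison for the lower far target seen from the pinch point `e₂`:
`⟨σ₀σ_{8me₁}⟩ ≤ ⟨σ_{e₂}σ_{dn m}⟩ = ⟨σ₀σ_{dn m - e₂}⟩` for `m ≥ 1`, since `3‖dn m - e₂‖_∞ = 6m ≤ 8m`.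
[cite: AizenmanDuminilCopinAnnals2021, §5.1 eq. (5.3)] -/
theorem cc2_xR_four_mul_le_cc2_e₂_dn {m : ℕ} (hm : 1 ≤ m) :
    cc2 0 (xR (4 * m)) ≤ cc2 e₂ (dn m) := by
  show criticalCorr 3 2 ![0, xR (4 * m)] ≤ criticalCorr 3 2 ![e₂, dn m]
  rw [criticalCorr_two_pair, criticalCorr_two_pair, sub_zero]
  apply twoPointPlus_le_of_mul_supNorm_le (criticalBeta_nonneg 3)
  calc 3 * Site.supNorm (dn m - e₂) ≤ 3 * (2 * m) := Nat.mul_le_mul_left _ (supNorm_dn_sub_e₂_le hm)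
    _ ≤ 8 * m := by omega
    _ ≤ Site.supNorm (xR (4 * m)) := le_supNorm_xR_four_mul m

/-! ### The doubling pigeonhole along the first axis -/

/-- **Doubling scales are unbounded.** For infinitely many `m ≥ 1`,
`⟨σ₀σ_{2me₁}⟩ ≤ 64·⟨σ₀σ_{8me₁}⟩`: otherwise, from some `m₀` on, `⟨σ₀σ_{2m₀4^k e₁}⟩ < 64^{-k}`, which
contradicts the lower bound `⟨σ₀σ_x⟩_{β_c} ≥ c‖x‖⁻²` of the critical two-point function of `ℤ³`
(`64^{-k} = o(16^{-k})`). [folklore] -/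
theorem frequently_doubling :
    ∃ᶠ m : ℕ in atTop, 1 ≤ m ∧ cc2 0 (xR m) ≤ 64 * cc2 0 (xR (4 * m)) := by
  obtain ⟨c, hc, hlow⟩ := softPackageNoBubble_criticalCorr.lower
  rw [Filter.frequently_atTop]
  intro a
  by_contra hcon
  push Not at hcon
  obtain ⟨m₀, hm₀a, hm₀1⟩ : ∃ m₀ : ℕ, a ≤ m₀ ∧ 1 ≤ m₀ := ⟨max a 1, le_max_left _ _, le_max_right _ _⟩
  -- geometric decay along `m₀ 4^k`
  have hdec : ∀ k : ℕ, cc2 0 (xR (m₀ * 4 ^ k)) ≤ (((1 : ℝ) / 4) ^ k) ^ 3 := by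
    intro k
    induction k with
    | zero => simpa using softPackageNoBubble_criticalCorr.le_one 0 (xR m₀)
    | succ k ih =>
      have hpos : 0 < 4 ^ k := pow_pos (by norm_num) k
      have hk1 : 1 ≤ m₀ * 4 ^ k := le_trans hm₀1 (Nat.le_mul_of_pos_right _ hpos)
      have hka : a ≤ m₀ * 4 ^ k := le_trans hm₀a (Nat.le_mul_of_pos_right _ hpos)
      have h := hcon (m₀ * 4 ^ k) hka hk1
      have heq : m₀ * 4 ^ (k + 1) = 4 * (m₀ * 4 ^ k) := by ring
      have hstep : (((1 : ℝ) / 4) ^ (k + 1)) ^ 3 = (((1 : ℝ) / 4) ^ k) ^ 3 / 64 := by ring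
      rw [heq, hstep]
      linarith
  -- the polynomial lower bound along `m₀ 4^k`
  have hlow' : ∀ k : ℕ,
      c * ((2 * (m₀ : ℝ)) ^ 2)⁻¹ * (((1 : ℝ) / 4) ^ k) ^ 2 ≤ cc2 0 (xR (m₀ * 4 ^ k)) := by
    intro k
    have hm0 : (0 : ℤ) < m₀ := by exact_mod_cast hm₀1
    have hx : xR (m₀ * 4 ^ k) ≠ 0 := by
      intro h
      have h0 := congrFun h 0
      have h1 : (xR (m₀ * 4 ^ k)) 0 = 2 * ((m₀ * 4 ^ k : ℕ) : ℤ) := by simp [xR]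
      rw [h1, Pi.zero_apply] at h0
      push_cast at h0
      have h2 : (0 : ℤ) < 2 * ((m₀ : ℤ) * 4 ^ k) := mul_pos two_pos (mul_pos hm0 (pow_pos (by norm_num) k))
      linarith
    have h := hlow _ hx
    rw [norm_xR] at h
    have hm0' : (0 : ℝ) < m₀ := by exact_mod_cast hm₀1
    have hrpow : (2 * ((m₀ * 4 ^ k : ℕ) : ℝ)) ^ (-(2 : ℝ)) =
        ((2 * (m₀ : ℝ)) ^ 2)⁻¹ * (((1 : ℝ) / 4) ^ k) ^ 2 := by
      rw [Real.rpow_neg (by positivity), Real.rpow_two]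
      push_cast
      rw [one_div, inv_pow, inv_pow, ← mul_inv]
      congr 1
      ring
    calc c * ((2 * (m₀ : ℝ)) ^ 2)⁻¹ * (((1 : ℝ) / 4) ^ k) ^ 2
        = c * (2 * ((m₀ * 4 ^ k : ℕ) : ℝ)) ^ (-(2 : ℝ)) := by rw [hrpow, mul_assoc]
      _ ≤ cc2 0 (xR (m₀ * 4 ^ k)) := h
  -- comparison: `c (2m₀)⁻² ≤ 4^{-k}` for all `k`, absurd
  have hkey : ∀ k : ℕ, c * ((2 * (m₀ : ℝ)) ^ 2)⁻¹ ≤ ((1 : ℝ) / 4) ^ k := by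
    intro k
    have ht : (0 : ℝ) < (((1 : ℝ) / 4) ^ k) ^ 2 := by positivity
    have h := (hlow' k).trans (hdec k)
    rw [show (((1 : ℝ) / 4) ^ k) ^ 3 = ((1 : ℝ) / 4) ^ k * (((1 : ℝ) / 4) ^ k) ^ 2 by ring] at h
    exact le_of_mul_le_mul_right h ht
  have hA : (0 : ℝ) < c * ((2 * (m₀ : ℝ)) ^ 2)⁻¹ := by
    have : (0 : ℝ) < m₀ := by exact_mod_cast hm₀1
    positivity
  obtain ⟨k, hk⟩ := exists_pow_lt_of_lt_one hA (by norm_num : (1 : ℝ) / 4 < 1)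
  exact absurd (hkey k) (not_le.2 hk)

/-! ### Infinite volume: the gap bounds the two-current avoidance probability -/

/-- **Energy factorisation + positivity.** For every `m`, the first cross term of Aizenman's
factorisation of `⟨σ₀σ_{e₂} ; σ_{up m}σ_{dn m}⟩` is bounded by the whole truncation (the second cross
term `G(0,dn)G(e₂,up)(1 - P^{0 dn,e₂ up}_∞[0 ↔ e₂])` is nonnegative, `P_∞` being a probability measure):
`⟨σ₀σ_{up m}⟩⟨σ_{e₂}σ_{dn m}⟩(1 - P^{0 up,e₂ dn}_∞[0 ↔ e₂]) ≤ ⟨σ₀σ_{e₂}σ_{up}σ_{dn}⟩ - ⟨σ₀σ_{e₂}⟩⟨σ_{up}σ_{dn}⟩ ≤ B`.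
[cite: AizenmanDuminilCopinAnnals2021, eq. (3.11)] -/
theorem mul_one_sub_probInf_le {m : ℕ} {B : ℝ}
    (hgap : criticalCorr 3 4 ![0, e₂, up m, dn m] - cc2 0 e₂ * cc2 (up m) (dn m) ≤ B) :
    cc2 0 (up m) * cc2 e₂ (dn m) *
        (1 - (sourcedDoubleCurrentLawInf 3 (criticalBeta 3) ({0} ∆ {up m}) ({e₂} ∆ {dn m})).real
          (openConn 0 e₂)) ≤ B := by
  have hβ : 0 < criticalBeta 3 := criticalBeta_pos_holds (d := 3) (by norm_num)
  haveI := isProbabilityMeasure_sourcedDoubleCurrentLawInf (d := 3) hβ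
    (even_card_singleton_symmDiff (0 : Site 3) (dn m)) (even_card_singleton_symmDiff e₂ (up m))
  have hfac := energyFactorisation_criticalCorr 0 e₂ (up m) (dn m)
  have hP2 : (sourcedDoubleCurrentLawInf 3 (criticalBeta 3) ({0} ∆ {dn m}) ({e₂} ∆ {up m})).real
      (openConn 0 e₂) ≤ 1 := measureReal_le_one
  have h3 : 0 ≤ criticalCorr 3 2 ![0, dn m] := (softPackageNoBubble_criticalCorr.pos 0 (dn m)).le
  have h4 : 0 ≤ criticalCorr 3 2 ![e₂, up m] := (softPackageNoBubble_criticalCorr.pos e₂ (up m)).le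
  have hprod : 0 ≤ criticalCorr 3 2 ![0, dn m] * criticalCorr 3 2 ![e₂, up m] *
      (1 - (sourcedDoubleCurrentLawInf 3 (criticalBeta 3) ({0} ∆ {dn m}) ({e₂} ∆ {up m})).real
        (openConn 0 e₂)) := mul_nonneg (mul_nonneg h3 h4) (by linarith)
  change criticalCorr 3 4 ![0, e₂, up m, dn m] - criticalCorr 3 2 ![0, e₂] * criticalCorr 3 2 ![up m, dn m]
    ≤ B at hgap
  change criticalCorr 3 2 ![0, up m] * criticalCorr 3 2 ![e₂, dn m] * _ ≤ B
  linarith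

/-! ### The stub -/

/-- **S2 — one-pinch screening decay from the one-pinch gap.** `ScreeningIdentity → OnePinchGap →
OnePinchScreeningDecay`: with `κ = κ'` and `C' = 4096·max(C,0) + 1`, for the infinitely many doubling
scales `m` (`⟨σ₀σ_{2me₁}⟩ ≤ 64⟨σ₀σ_{8me₁}⟩`, `frequently_doubling`), eventually in the box size `n`,
`pinchScreen n n m = 1 - P^{0 up,e₂ dn}_{Λ_n}[0 ↔ e₂] ≤ (1 - P_∞[0 ↔ e₂]) + m^{-κ'} ≤ C' m^{-κ'}`
(energy factorisation (3.11) + the gap; MMS in the sup norm; box passage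
`tendsto_sourcedDoubleCurrentLaw_real_openConn`; the dictionary `ScreeningIdentity`).
[cite: AizenmanDuminilCopinAnnals2021, eq. (3.11) and Lemma A.1] -/
theorem stub_screeningDecay : ScreeningIdentity → OnePinchGap → OnePinchScreeningDecay := by
  intro hSI hGap
  obtain ⟨κ, C, hκ, hC⟩ := hGap
  refine ⟨κ, max C 0 * 4096 + 1, hκ, ?_⟩
  refine frequently_doubling.mono ?_
  rintro m ⟨hm, hdoub⟩
  have hβ : 0 < criticalBeta 3 := criticalBeta_pos_holds (d := 3) (by norm_num)
  haveI := isProbabilityMeasure_sourcedDoubleCurrentLawInf (d := 3) hβ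
    (even_card_singleton_symmDiff (0 : Site 3) (up m)) (even_card_singleton_symmDiff e₂ (dn m))
  have hPinf1 : (sourcedDoubleCurrentLawInf 3 (criticalBeta 3) ({0} ∆ {up m}) ({e₂} ∆ {dn m})).real
      (openConn 0 e₂) ≤ 1 := measureReal_le_one
  have hm0 : (0 : ℝ) < m := by exact_mod_cast hm
  have hmk : (0 : ℝ) < (m : ℝ) ^ (-κ) := Real.rpow_pos_of_pos hm0 _
  -- (i) + (iii): the infinite-volume avoidance at a doubling scale
  have hinf : 1 - (sourcedDoubleCurrentLawInf 3 (criticalBeta 3) ({0} ∆ {up m}) ({e₂} ∆ {dn m})).real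
      (openConn 0 e₂) ≤ max C 0 * 4096 * (m : ℝ) ^ (-κ) := by
    have h1 := mul_one_sub_probInf_le (hC m hm)
    rw [softPackageNoBubble_criticalCorr.two (xR m)] at h1
    have hgpos : 0 < cc2 0 (xR (4 * m)) := softPackageNoBubble_criticalCorr.pos 0 (xR (4 * m))
    have hG1 : cc2 0 (xR (4 * m)) ≤ cc2 0 (up m) := cc2_xR_four_mul_le_cc2_up m
    have hG2 : cc2 0 (xR (4 * m)) ≤ cc2 e₂ (dn m) := cc2_xR_four_mul_le_cc2_e₂_dn hm
    have hx0 : 0 ≤ cc2 0 (xR m) := (softPackageNoBubble_criticalCorr.pos 0 (xR m)).le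
    have h2m : (2 * (m : ℝ)) ^ (-κ) ≤ (m : ℝ) ^ (-κ) :=
      Real.rpow_le_rpow_of_nonpos hm0 (by linarith) (by linarith [hκ.le])
    have h2m0 : 0 ≤ (2 * (m : ℝ)) ^ (-κ) := Real.rpow_nonneg (by positivity) _
    have hsq : cc2 0 (xR m) ^ 2 ≤ (64 * cc2 0 (xR (4 * m))) ^ 2 := pow_le_pow_left₀ hx0 hdoub 2
    have hA : cc2 0 (xR (4 * m)) * cc2 0 (xR (4 * m)) *
        (1 - (sourcedDoubleCurrentLawInf 3 (criticalBeta 3) ({0} ∆ {up m}) ({e₂} ∆ {dn m})).real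
          (openConn 0 e₂)) ≤
        cc2 0 (up m) * cc2 e₂ (dn m) *
        (1 - (sourcedDoubleCurrentLawInf 3 (criticalBeta 3) ({0} ∆ {up m}) ({e₂} ∆ {dn m})).real
          (openConn 0 e₂)) := by
      apply mul_le_mul_of_nonneg_right _ (by linarith)
      exact mul_le_mul hG1 hG2 hgpos.le (hgpos.le.trans hG1)
    have hB1 : C * (2 * (m : ℝ)) ^ (-κ) * cc2 0 (xR m) ^ 2 ≤
        max C 0 * (2 * (m : ℝ)) ^ (-κ) * cc2 0 (xR m) ^ 2 :=
      mul_le_mul_of_nonneg_right (mul_le_mul_of_nonneg_right (le_max_left _ _) h2m0) (sq_nonneg _)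
    have hB2 : max C 0 * (2 * (m : ℝ)) ^ (-κ) * cc2 0 (xR m) ^ 2 ≤
        max C 0 * (m : ℝ) ^ (-κ) * (64 * cc2 0 (xR (4 * m))) ^ 2 :=
      mul_le_mul (mul_le_mul_of_nonneg_left h2m (le_max_right _ _)) hsq (sq_nonneg _)
        (mul_nonneg (le_max_right _ _) hmk.le)
    have hchain := hA.trans (h1.trans (hB1.trans hB2))
    have hC' : (1 - (sourcedDoubleCurrentLawInf 3 (criticalBeta 3) ({0} ∆ {up m}) ({e₂} ∆ {dn m})).real
          (openConn 0 e₂)) * (cc2 0 (xR (4 * m)) * cc2 0 (xR (4 * m))) ≤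
        (max C 0 * 4096 * (m : ℝ) ^ (-κ)) * (cc2 0 (xR (4 * m)) * cc2 0 (xR (4 * m))) := by
      calc (1 - (sourcedDoubleCurrentLawInf 3 (criticalBeta 3) ({0} ∆ {up m}) ({e₂} ∆ {dn m})).real
              (openConn 0 e₂)) * (cc2 0 (xR (4 * m)) * cc2 0 (xR (4 * m)))
          = cc2 0 (xR (4 * m)) * cc2 0 (xR (4 * m)) *
              (1 - (sourcedDoubleCurrentLawInf 3 (criticalBeta 3) ({0} ∆ {up m}) ({e₂} ∆ {dn m})).real
                (openConn 0 e₂)) := by ring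
        _ ≤ max C 0 * (m : ℝ) ^ (-κ) * (64 * cc2 0 (xR (4 * m))) ^ 2 := hchain
        _ = (max C 0 * 4096 * (m : ℝ) ^ (-κ)) * (cc2 0 (xR (4 * m)) * cc2 0 (xR (4 * m))) := by ring
    exact le_of_mul_le_mul_right hC' (by positivity)
  -- (ii) box passage
  have hlim := tendsto_sourcedDoubleCurrentLaw_real_openConn (d := 3) (by norm_num) hβ le_rfl
    0 (up m) e₂ (dn m)
  have hev : ∀ᶠ n : ℕ in atTop,
      (sourcedDoubleCurrentLawInf 3 (criticalBeta 3) ({0} ∆ {up m}) ({e₂} ∆ {dn m})).real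
          (openConn 0 e₂) - (m : ℝ) ^ (-κ) <
        (sourcedDoubleCurrentLaw 3 n (criticalBeta 3) ({0} ∆ {up m}) ({e₂} ∆ {dn m})).real
          (openConn 0 e₂) :=
    hlim.eventually_const_lt (by linarith)
  obtain ⟨L₀, hL₀⟩ := exists_forall_subset_box 3 ({0, up m, e₂, dn m} : Finset (Site 3))
  filter_upwards [hev, eventually_ge_atTop L₀] with n hn hnL
  have hsub := hL₀ n hnL
  have h0 : (0 : Site 3) ∈ box 3 n := hsub (by simp)
  have hup : up m ∈ box 3 n := hsub (by simp)
  have he₂ : e₂ ∈ box 3 n := hsub (by simp)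
  have hdn : dn m ∈ box 3 n := hsub (by simp)
  rw [pinchScreen_full, hSI n 0 (up m) e₂ (dn m) h0 hup he₂ hdn]
  calc 1 - (sourcedDoubleCurrentLaw 3 n (criticalBeta 3) ({0} ∆ {up m}) ({e₂} ∆ {dn m})).real
          (openConn 0 e₂)
      ≤ 1 - (sourcedDoubleCurrentLawInf 3 (criticalBeta 3) ({0} ∆ {up m}) ({e₂} ∆ {dn m})).real
          (openConn 0 e₂) + (m : ℝ) ^ (-κ) := by linarith
    _ ≤ max C 0 * 4096 * (m : ℝ) ^ (-κ) + (m : ℝ) ^ (-κ) := by linarith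
    _ = (max C 0 * 4096 + 1) * (m : ℝ) ^ (-κ) := by ring

end Summit.CriticalPhenomena.Ising3DConformalLimit.EnergyNotSigmaSquaredGapForcesFarMerging

end
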